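import Literature.AlgebraicGeometry.Resolution.CompositeValuationsCofinal
import Mathlib.RingTheory.AlgebraicIndependent.TranscendenceBasis
import Mathlib.FieldTheory.IntermediateField.Adjoin.Defs
import Mathlib.RingTheory.Valuation.ValuationSubring
import Mathlib.Algebra.MvPolynomial.Eval
import HarnessLib

/-!
# Value torsion over the lattice of a transcendence basis with independent values

Crux `Valuative.LuAlphaPTorsor` (stmt-ResolutionOfSingularities-0641), line `pfaff-line-log-final-forms`,
lead seat c4 — for the assembly of the rank `≥ 2` Abhyankar core: the level induction S3*
(`ap_adaptedPerron_flag`) needs, for the current parameters `x`, that every value of `K^×` has a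
power in the lattice spanned by the `v(xᵢ)` ("value torsion"). For the BASE chart this follows
from `IsTranscendenceBasis k x` (`stub_adaptedHenselRootChart`) and the `ℤ`-independence of the
`v(xᵢ)`: every `z ∈ K^×` is algebraic over `k(x)`, so `v(zⁿ) = v(e)` for some `e ∈ k(x)^×`
(`exists_pow_valuation_eq_of_isAlgebraic`, `CompositeValuationsCofinal.lean`), and the value of
a non-zero element of `k(x)` is the value of a Laurent monomial in `x` (the monomial valuation:
the values of distinct monomials of a polynomial are distinct, so the dominant one wins,
`Valuation.map_sum_eq_of_lt`). Registered anchor (closed form): `ap_htors_of_isTranscendenceBasis`.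
[folklore]
-/

set_option linter.dupNamespace false

open IsLocalRing

namespace Summit.ResolutionOfSingularities.ResolutionOfSingularities.Theorems.PfaffLine

open Literature.AlgebraicGeometry.Resolution

section Torsion

variable {k K : Type} [Field k] [Field K] [Algebra k K]

/-- Non-zero scalars are `O`-units when `k ⊆ O`. [folklore] -/
theorem ap_valuation_algebraMap_eq_one (O : ValuationSubring K) (hk : ∀ c : k, algebraMap k K c ∈ O)
    {c : k} (hc : c ≠ 0) : O.valuation (algebraMap k K c) = 1 := by
  apply le_antisymm ((O.valuation_le_one_iff _).mpr (hk c))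
  have h := (O.valuation_le_one_iff _).mpr (hk c⁻¹)
  rw [map_inv₀, map_inv₀] at h
  have h0 : O.valuation (algebraMap k K c) ≠ 0 := (map_ne_zero _).mpr ((map_ne_zero _).mpr hc)
  exact (inv_le_one₀ (zero_lt_iff.mpr h0)).mp h

/-- **The monomial valuation on `k[x]`**: if the values of the `xᵢ` are `ℤ`-independent, the
value of a non-zero polynomial expression in `x` is the value of one of its monomials.
[folklore] -/
theorem ap_valuation_aeval_eq_monomial (O : ValuationSubring K) (hk : ∀ c : k, algebraMap k K c ∈ O)
    {n : ℕ} (x : Fin n → K) (hx0 : ∀ i, x i ≠ 0)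
    (hind : ∀ m : Fin n → ℤ, (∏ i, O.valuation (x i) ^ (m i)) = 1 → m = 0)
    (P : MvPolynomial (Fin n) k) (hP : P ≠ 0) :
    ∃ m : Fin n → ℤ, O.valuation (MvPolynomial.aeval x P) = ∏ i, O.valuation (x i) ^ (m i) := by
  classical
  have hvx0 : ∀ i, O.valuation (x i) ≠ 0 := fun i => (map_ne_zero _).mpr (hx0 i)
  -- the value of the monomial `d`
  have hmon : ∀ d ∈ P.support, O.valuation (MvPolynomial.aeval x (MvPolynomial.monomial d (P.coeff d))) =
      ∏ i, O.valuation (x i) ^ ((d i : ℤ)) := by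
    intro d hd
    rw [MvPolynomial.aeval_monomial, map_mul, ap_valuation_algebraMap_eq_one O hk (MvPolynomial.mem_support_iff.mp hd),
      one_mul, Finsupp.prod_fintype _ _ (fun i => by simp), map_prod]
    exact Finset.prod_congr rfl fun i _ => by rw [map_pow, zpow_natCast]
  -- distinct monomials have distinct values
  have hinj : ∀ d d' : Fin n →₀ ℕ, (∏ i, O.valuation (x i) ^ ((d i : ℤ))) = ∏ i, O.valuation (x i) ^ ((d' i : ℤ)) → d = d' := by
    intro d d' h
    have h1 : (∏ i, O.valuation (x i) ^ ((d i : ℤ) - d' i)) = 1 := by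
      have : (∏ i, O.valuation (x i) ^ ((d i : ℤ) - d' i)) =
          (∏ i, O.valuation (x i) ^ ((d i : ℤ))) * (∏ i, O.valuation (x i) ^ ((d' i : ℤ)))⁻¹ := by
        rw [← Finset.prod_inv_distrib, ← Finset.prod_mul_distrib]
        exact Finset.prod_congr rfl fun i _ => by rw [zpow_sub₀ (hvx0 i), div_eq_mul_inv]
      rw [this, h, mul_inv_cancel₀]
      exact Finset.prod_ne_zero_iff.mpr fun i _ => zpow_ne_zero _ (hvx0 i)
    have h2 := hind _ h1
    ext i
    have := congrFun h2 i
    simp only [Pi.zero_apply, sub_eq_zero, Nat.cast_inj] at this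
    exact this
  -- the dominant monomial
  have hne : P.support.Nonempty := MvPolynomial.support_nonempty.mpr hP
  obtain ⟨d₀, hd₀, hmax⟩ := Finset.exists_max_image P.support
    (fun d => ∏ i, O.valuation (x i) ^ ((d i : ℤ))) hne
  refine ⟨fun i => (d₀ i : ℤ), ?_⟩
  conv_lhs => rw [P.as_sum, map_sum]
  rw [Valuation.map_sum_eq_of_lt _ (j := d₀) hd₀, hmon d₀ hd₀]
  intro d hd
  rw [Finset.mem_sdiff, Finset.mem_singleton] at hd
  rw [hmon d hd.1, hmon d₀ hd₀]
  exact lt_of_le_of_ne (hmax d hd.1) fun h => hd.2 (hinj d d₀ h)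

/-- **Value torsion over a transcendence basis with independent values** (registered anchor):
every value of `K^×` has a power in the lattice spanned by the `v(xᵢ)`. [folklore] -/
theorem ap_htors_of_isTranscendenceBasis : ∀ {k K : Type} [Field k] [Field K] [Algebra k K] (O : ValuationSubring K), (∀ c : k, algebraMap k K c ∈ O) → ∀ {n : ℕ} (x : Fin n → K), (∀ i, x i ≠ 0) → (∀ m : Fin n → ℤ, (∏ i, O.valuation (x i) ^ (m i)) = 1 → m = 0) → IsTranscendenceBasis k x → ∀ z : K, z ≠ 0 → ∃ N : ℕ, N ≠ 0 ∧ ∃ m : Fin n → ℤ, O.valuation z ^ N = ∏ i, O.valuation (x i) ^ (m i) := by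
  intro k K _ _ _ O hk n x hx0 hind htb z hz0
  classical
  -- `z` is algebraic over the subfield `k(x)`
  set E : IntermediateField k K := IntermediateField.adjoin k (Set.range x) with hE
  haveI := htb.isAlgebraic
  have halgA : IsAlgebraic (Algebra.adjoin k (Set.range x)) z := Algebra.IsAlgebraic.isAlgebraic z
  have hAE : Algebra.adjoin k (Set.range x) ≤ E.toSubalgebra := Algebra.adjoin_le (IntermediateField.subset_adjoin k _)
  have hAE' : (Algebra.adjoin k (Set.range x)).toSubring ≤ E.toSubfield.toSubring := fun w hw => hAE hw
  have halg : IsAlgebraic E.toSubfield z := by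
    obtain ⟨P, hP0, hPz⟩ := halgA
    set f : (Algebra.adjoin k (Set.range x)).toSubring →+* E.toSubfield.toSubring := Subring.inclusion hAE' with hf
    refine ⟨P.map f, ?_, ?_⟩
    · intro h
      apply hP0
      apply Polynomial.map_injective f (Subring.inclusion_injective hAE')
      rw [h, Polynomial.map_zero]
    · have hcomp : (algebraMap E.toSubfield K).comp f = algebraMap (Algebra.adjoin k (Set.range x)) K := by
        ext w; rfl
      rw [Polynomial.aeval_def, Polynomial.eval₂_map, hcomp]
      rw [Polynomial.aeval_def] at hPz
      exact hPz
  obtain ⟨N, hN, e, heE, he0, hval⟩ := exists_pow_valuation_eq_of_isAlgebraic O E.toSubfield hz0 halg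
  -- `e = r / s` with `r, s ∈ k[x]`
  have heE' : e ∈ E := heE
  rw [hE, IntermediateField.mem_adjoin_iff_div] at heE'
  obtain ⟨r, hr, s, hs, hers⟩ := heE'
  rw [Algebra.adjoin_range_eq_range_aeval] at hr hs
  obtain ⟨Pr, rfl⟩ := hr
  obtain ⟨Ps, rfl⟩ := hs
  change e = MvPolynomial.aeval x Pr / MvPolynomial.aeval x Ps at hers
  have hr0 : MvPolynomial.aeval x Pr ≠ 0 := by
    intro h; apply he0; rw [hers, h, zero_div]
  have hs0 : MvPolynomial.aeval x Ps ≠ 0 := by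
    intro h; apply he0; rw [hers, h, div_zero]
  have hPr : Pr ≠ 0 := by rintro rfl; exact hr0 (map_zero _)
  have hPs : Ps ≠ 0 := by rintro rfl; exact hs0 (map_zero _)
  obtain ⟨mr, hmr⟩ := ap_valuation_aeval_eq_monomial O hk x hx0 hind Pr hPr
  obtain ⟨ms, hms⟩ := ap_valuation_aeval_eq_monomial O hk x hx0 hind Ps hPs
  have hvx0 : ∀ i, O.valuation (x i) ≠ 0 := fun i => (map_ne_zero _).mpr (hx0 i)
  refine ⟨N, Nat.pos_iff_ne_zero.mp hN, mr - ms, ?_⟩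
  rw [← map_pow, hval, hers, map_div₀, hmr, hms, ← Finset.prod_div_distrib]
  exact Finset.prod_congr rfl fun i _ => by rw [Pi.sub_apply, zpow_sub₀ (hvx0 i)]

end Torsion

end Summit.ResolutionOfSingularities.ResolutionOfSingularities.Theorems.PfaffLine
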